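import Summits.CriticalPhenomena.PercolationContinuityZ3.Theorems.PercNearOneGluingNoHeavyLowerTailSahiCTCCoLevelDuality
import Summits.CriticalPhenomena.PercolationContinuityZ3.Theorems.PercNearOneGluingNoHeavyLowerTailSahiAtLeastTwoRowA

/-!
# `NoHeavyLowerTail` (crux stmt-CriticalPhenomena-4575), Sahi / Kahn positivity: THE THRESHOLD CERTIFICATE `ρ_{k−1}` FOR THE SLOT
# "AT LEAST ONE OF k OPEN" WITH ALL ROWS DISCHARGED, EVERY `k ≥ 1` — CTC_{k−1}(k) on the pattern cube and the unconditional endpoint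

Support file (cell `prim-l12`, seat P3, gen 24; `--supports stmt-CriticalPhenomena-4575`).  No `sorry`, no named facts, standard axioms.  Memo
`run/shared/lean/prim/prim-l12/FROM-prim-l12-p3-g24-VALUE-LEVEL-TH2K.md` §3.

`…SahiAllButC.rhoCert_allBut` turns `ρ_c = μ(· | exactly c closed)` into Kahn's Conjecture 5 / Sahi's `C₃` for the slot `allBut c k = Th_{k−c}^k` given
row (a) and the (TC) row `Ñ_c(K_𝒳,K_𝒵)(r) ≥ 0`.  For the CO-level `c = k − 1` (the slot "at least one of the `k` coordinates open", the hitting /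
OR slot) both rows are now theorems for every `k ≥ 1`:
* `cx_eq_coFam` : the complex of closed sets `K_𝒳 = cx 𝒳` is the member-complement family of the open sets (`openFam`), so
  **`coeff_Ngen_cx_colevel_nonneg` : `Ñ_{k−1}(K_𝒳,K_𝒵) ∈ ℕ[r]` for all up-sets `𝒳, 𝒵` of the pattern cube — CTC_{k−1}(k), every `k ≥ 1`**
  (`…SahiCTCCoLevelDuality.coeff_Ngen_colevel_coFam_nonneg` ← `…SahiCTCCoLevelOne.coeff_M1_nonneg`);
* `aRow_colevel_one` : row (a) at the odds (`…SahiCTCCoLevelDuality.coeff_aPoly_colevel_one_nonneg`);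
* **`rhoCert_atLeastOne`** : `ρ_{k−1}` is a reduced transport certificate of `allBut (k−1) k`;
* **`sahiE_three_nonneg_atLeastOne`** : `E₃(1_H, 1_U, 1_V) ≥ 0` for a block-determined `H` with pattern "at least one open", ALL increasing `U, V`,
  every dimension, interior parameters — unconditional.  (The slot was first settled by `…SahiHittingSlot` with a two-copy Harris certificate;
  this is the first co-level member of the uniform family `ρ_c` closed for every `k`, and the model for `Th₂ᵏ` of `…SahiAtLeastTwoRowA`, whose
  remaining input is the value-level (TC) row of memo g24 §1.)
Nothing is asserted about the crux.
-/

/-! ### The endpoint: CTC_{k−1}(k) and the certificate `ρ_{k−1}` for the slot "at least one of `k` open", every `k ≥ 1` -/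

noncomputable section

open scoped Classical

namespace Summit.CriticalPhenomena.PercolationContinuityZ3.Theorems

namespace SahiAllButC

open Finset MvPolynomial
open SahiHittingSlot SahiTransportCert SahiAllButOne SahiAllButTwo SahiCTCForms SahiCTCGenFun SahiCTCWeightedLYM
open Literature.Combinatorics.Sahi2008
open Literature.Probability.Percolation (DeterminedBy)
open Literature.Probability.Percolation.DecisionTree (ind)

variable {k : ℕ}

/-- The open sets of an event on the pattern cube, as a family of finsets. [this work] -/
def openFam (𝒳 : Set (Set (Fin k))) : Finset (Finset (Fin k)) := univ.filter fun T => (↑T : Set (Fin k)) ∈ 𝒳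

/-- **`K_𝒳 = coFam(open sets)`**: the complex of closed sets of `𝒳` is the member-complement family of its open sets. [this work] -/
theorem cx_eq_coFam (𝒳 : Set (Set (Fin k))) : cx 𝒳 = coFam (openFam 𝒳) := by
  ext C
  rw [mem_cx, mem_coFam]
  unfold openFam
  simp only [mem_filter, mem_univ, true_and, coe_sdiff, coe_univ, Set.compl_eq_univ_sdiff]

/-- The open-set family of an up-set is an up-set. [this work] -/
theorem isUpperSet_openFam {𝒳 : Set (Set (Fin k))} (h𝒳 : IsUpperSet 𝒳) :
    IsUpperSet ((openFam 𝒳 : Finset (Finset (Fin k))) : Set (Finset (Fin k))) := by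
  intro S T hST hS
  rw [Finset.mem_coe] at hS ⊢
  unfold openFam at hS ⊢
  simp only [mem_filter, mem_univ, true_and] at hS ⊢
  exact h𝒳 (Finset.coe_subset.2 hST) hS

/-- **CTC_{k−1}(k) for every `k ≥ 1`**: `Ñ_{k−1}(K_𝒳, K_𝒵) ∈ ℕ[r]` for all up-sets `𝒳, 𝒵` of the pattern cube. [this work] -/
theorem coeff_Ngen_cx_colevel_nonneg (hk : 1 ≤ k) {𝒳 𝒵 : Set (Set (Fin k))} (h𝒳 : IsUpperSet 𝒳) (h𝒵 : IsUpperSet 𝒵) :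
    ∀ n, 0 ≤ (Ngen (k - 1) (cx 𝒳) (cx 𝒵)).coeff n := by
  have hV : 0 < Fintype.card (Fin k) := by rw [Fintype.card_fin]; omega
  have h := coeff_Ngen_colevel_coFam_nonneg hV (isUpperSet_openFam h𝒳) (isUpperSet_openFam h𝒵)
  rw [Fintype.card_fin] at h
  rw [cx_eq_coFam, cx_eq_coFam]; exact h

/-- **Row (a) at level `k − 1` at the odds vector**, every `k ≥ 1`. [this work] -/
theorem aRow_colevel_one {q : Fin k → unitInterval} (hq : ∀ i, 0 < (q i : ℝ) ∧ (q i : ℝ) < 1) (hk : 1 ≤ k) :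
    ev q (ThC (k - 1)) * ev q (DdC (k - 1)) ≤ (ev q PiP + ev q (DdC (k - 1))) * ev q (ee (k - 1) : MvPolynomial (Fin k) ℤ) := by
  have hK : 0 < Fintype.card (Fin k) := by rw [Fintype.card_fin]; omega
  have h := eval_le_of_coeff_le (P := (0 : MvPolynomial (Fin k) ℤ))
    (Q := (PiP + DdC (k - 1)) * ee (k - 1) - ThC (k - 1) * DdC (k - 1))
    (fun m => by
      rw [coeff_zero]
      have := coeff_aPoly_colevel_one_nonneg (α := Fin k) hK m
      rwa [Fintype.card_fin] at this) (r q) (r_nonneg hq)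
  rw [eval₂_zero, eval₂_sub, eval₂_mul, eval₂_mul, eval₂_add, sub_nonneg] at h
  exact h

/-- **THE CERTIFICATE `ρ_{k−1} = μ(· | exactly one open)` FOR "AT LEAST ONE OF `k` OPEN", ALL ROWS DISCHARGED** (`k ≥ 1`, interior
parameters). [this work] -/
theorem rhoCert_atLeastOne {q : Fin k → unitInterval} (hq : ∀ i, 0 < (q i : ℝ) ∧ (q i : ℝ) < 1) (hk : 1 ≤ k) :
    RhoCert q (allBut (k - 1) k) (rhoC q (k - 1)) :=
  rhoCert_allBut hq (by omega) (aRow_colevel_one hq hk) (fun 𝒳 𝒵 h𝒳 h𝒵 _ _ => by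
    have h := eval_le_of_coeff_le (P := (0 : MvPolynomial (Fin k) ℤ)) (Q := Ngen (k - 1) (cx 𝒳) (cx 𝒵))
      (fun m => by rw [coeff_zero]; exact coeff_Ngen_cx_colevel_nonneg hk h𝒳 h𝒵 m) (r q) (r_nonneg hq)
    rw [eval₂_zero] at h; exact h)

/-- **KAHN'S CONJECTURE 5 / SAHI'S `C₃` FOR THE FIRST SLOT "AT LEAST ONE OF `k` OPEN" (the hitting / OR slot), EVERY `k ≥ 1`, THROUGH THE
THRESHOLD CERTIFICATE `ρ_{k−1}`** — unconditional: the (TC) row is `coeff_Ngen_cx_colevel_nonneg` (CTC_{k−1}(k)), row (a) is `aRow_colevel_one`.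
(The slot itself was settled by `…SahiHittingSlot` with a two-copy Harris certificate; this is the first co-level instance of the uniform
certificate family `ρ_c` closed for every `k`, the model for `Th₂ᵏ` of `…SahiAtLeastTwoRowA`.) [this work] -/
theorem sahiE_three_nonneg_atLeastOne {ι : Type} [Fintype ι] (p : ι → unitInterval) (e : Fin k ↪ ι) (hk : 1 ≤ k)
    (hp : ∀ i, 0 < (p (e i) : ℝ) ∧ (p (e i) : ℝ) < 1) {H : Set (Set ι)} (hH : DeterminedBy H (Set.range e))
    (hpat : pat e H = allBut (k - 1) k) {U V : Set (Set ι)} (hU : IsUpperSet U) (hV : IsUpperSet V) :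
    0 ≤ sahiE (bernoulliWeight p) 3 ![ind H, ind U, ind V] := by
  have hq : ∀ i, 0 < (pk e p i : ℝ) ∧ (pk e p i : ℝ) < 1 := hp
  exact sahiE_three_nonneg_of_allBut p e (c := k - 1) (by omega) hp (aRow_colevel_one hq hk)
    (fun 𝒳 𝒵 h𝒳 h𝒵 _ _ => by
      have h := eval_le_of_coeff_le (P := (0 : MvPolynomial (Fin k) ℤ)) (Q := Ngen (k - 1) (cx 𝒳) (cx 𝒵))
        (fun m => by rw [coeff_zero]; exact coeff_Ngen_cx_colevel_nonneg hk h𝒳 h𝒵 m) (r (pk e p)) (r_nonneg hq)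
      rw [eval₂_zero] at h; exact h) hH hpat hU hV

end SahiAllButC

end Summit.CriticalPhenomena.PercolationContinuityZ3.Theorems
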